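import Mathlib.Analysis.SpecialFunctions.Trigonometric.Basic
import Mathlib.RingTheory.KrullDimension.Polynomial
import Mathlib.RingTheory.KrullDimension.Field
import Mathlib.LinearAlgebra.LinearIndependent.Lemmas
import Mathlib.Data.Fin.VecNotation
import Literature.NumberTheory.Transcendental.ExpVarieties
import HarnessLib

/-!
# ℚ-independent exponential points on low-dimensional closed sets: the standard examples

For `W ⊆ ℂ² × ℂ²` (coordinates `x₁, x₂, y₁, y₂`, points `Fin 2 ⊕ Fin 2 → ℂ` as in
`ExpVarieties.lean`) write `indepExpPoints W = {x ∈ ℂ² | x ℚ-linearly independent, (x, eˣ) ∈ W}`.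
Schanuel's conjecture for `n = 2` predicts `indepExpPoints W = ∅` whenever `W` is Zariski closed,
DEFINED OVER ℚ (`IsDefinedOver ⊥ W`) and `zariskiDim ℂ W < 2` (a point of a ℚ-variety of dimension
`≤ 1` has transcendence degree `≤ 1`); the unconditional finiteness of `indepExpPoints W` under these
hypotheses is the open "sparsity at `n = 2`" statement of the Schanuel programme.

This file records the folklore examples showing that EACH hypothesis is load-bearing and that the
statement has genuine arithmetic content — facts any route through sparsity must respect:

* `infinite_indepExpPoints_expLineE`: the LINE `{x₂ = 1, y₁ = 1, y₂ = e}` — Zariski closed, of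
  dimension `≤ 1`, but defined over `ℚ(e)` and not over `ℚ̄` — carries the infinitely many
  ℚ-independent exponential points `(2πi(k+1), 1)`. So "closed of dimension ≤ 1" is not enough:
  methods blind to the field of definition (o-minimal counting, functional transcendence, complex
  analysis on `W`) cannot prove sparsity.
* `infinite_indepExpPoints_expPlaneQ`: the ℚ-PLANE `{x₂ = 1, y₁ = 1}` (dimension 2) carries the same
  points — the dimension bound `< 2` cannot be relaxed to `< 3`.
* `infinite_depExpPoints_expLineDep`: the ℚ-LINE `{y₁ = 1, y₂ = 1, x₂ = 2x₁}` carries the infinitely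
  many exponential points `(2πi(k+1), 4πi(k+1))` with pairwise distinct nonzero (but ℚ-dependent)
  coordinates — ℚ-linear independence of `x` cannot be weakened to non-degeneracy conditions.
* `infinite_indepExpPoints_expLineRat`: if `e^c = d` with `c, d ∈ ℚ`, `c ≠ 0`, the ℚ-LINE
  `{x₂ = c, y₁ = 1, y₂ = d}` carries `(2πi(k+1), c)`; contrapositively, sparsity at `n = 2` restricted
  to ℚ-lines already contains the irrationality of `e^c` (`c ∈ ℚˣ`), a Hermite–Lindemann-type input.

Tooling: `zariskiDim_le_of_coord_polys` (if every coordinate is, on `W`, a polynomial in `m` chosen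
coordinates then `zariskiDim W ≤ dim K[X_1..X_m]`), `ringKrullDim_mvPolynomial_fin_complex`.
All statements are elementary (periodicity of `exp`, real/imaginary parts); no transcendence theory
is used. Sources: folklore; the role of the field of definition is stressed in Kirby–Zilber's
treatment of exponential-algebraic closedness (Kirby 2013 §2) and in Marker's survey (2006, §1).
-/

namespace Literature.NumberTheory.Transcendental

open MvPolynomial Complex
open scoped Real

noncomputable section

/-! ## The counted set -/

/-- The ℚ-linearly independent exponential points of `W ⊆ ℂ² × ℂ²`: those `x ∈ ℂ²` with `x`
ℚ-linearly independent and `(x, eˣ) ∈ W` (the set Schanuel's conjecture for `n = 2` empties when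
`W` is a ℚ-variety of dimension `≤ 1`). [folklore] -/
def indepExpPoints (W : Set (Fin 2 ⊕ Fin 2 → ℂ)) : Set (Fin 2 → ℂ) :=
  {x : Fin 2 → ℂ | LinearIndependent ℚ x ∧ Sum.elim x (Complex.exp ∘ x) ∈ W}

/-- Membership in `indepExpPoints` (definitional). [folklore] -/
theorem mem_indepExpPoints_iff {W : Set (Fin 2 ⊕ Fin 2 → ℂ)} {x : Fin 2 → ℂ} :
    x ∈ indepExpPoints W ↔ LinearIndependent ℚ x ∧ Sum.elim x (Complex.exp ∘ x) ∈ W :=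
  Iff.rfl

/-! ## Dimension bookkeeping -/

/-- If on `W` every coordinate is a polynomial in the coordinates picked out by `f : κ → ι`, then
`zariskiDim ℂ W ≤ dim ℂ[X_κ]`: the coordinate ring `ℂ[X_ι] ⧸ I(W)` is a quotient of `ℂ[X_κ]`
via `X_k ↦ X_{f k}`. [folklore] -/
theorem zariskiDim_le_of_coord_polys {ι κ : Type*} (W : Set (ι → ℂ)) (f : κ → ι)
    (h : ∀ i, ∃ p : MvPolynomial κ ℂ, ∀ w ∈ W, w i = MvPolynomial.eval (fun k => w (f k)) p) :
    zariskiDim ℂ W ≤ ringKrullDim (MvPolynomial κ ℂ) := by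
  classical
  unfold zariskiDim
  set I : Ideal (MvPolynomial ι ℂ) := MvPolynomial.vanishingIdeal ℂ W with hI
  let φ : MvPolynomial κ ℂ →+* MvPolynomial ι ℂ ⧸ I :=
    (Ideal.Quotient.mk I).comp (MvPolynomial.rename f : MvPolynomial κ ℂ →ₐ[ℂ] MvPolynomial ι ℂ)
  have hφ : ∀ p, φ p = Ideal.Quotient.mk I (rename f p) := fun p => rfl
  refine ringKrullDim_le_of_surjective φ ?_
  have hX : ∀ i, ∃ p : MvPolynomial κ ℂ, φ p = Ideal.Quotient.mk I (X i) := by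
    intro i
    obtain ⟨p, hp⟩ := h i
    refine ⟨p, ?_⟩
    rw [hφ, Ideal.Quotient.eq, hI, MvPolynomial.mem_vanishingIdeal_iff]
    intro w hw
    rw [map_sub, MvPolynomial.aeval_rename, MvPolynomial.aeval_X, sub_eq_zero,
      MvPolynomial.aeval_eq_eval, hp w hw]
    rfl
  intro q
  obtain ⟨q, rfl⟩ := Ideal.Quotient.mk_surjective q
  induction q using MvPolynomial.induction_on with
  | C a => exact ⟨C a, by rw [hφ, rename_C]⟩
  | add p q hp hq =>
    obtain ⟨a, ha⟩ := hp
    obtain ⟨b, hb⟩ := hq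
    exact ⟨a + b, by rw [map_add, ha, hb, map_add]⟩
  | mul_X p i hp =>
    obtain ⟨a, ha⟩ := hp
    obtain ⟨b, hb⟩ := hX i
    exact ⟨a * b, by rw [map_mul, ha, hb, map_mul]⟩

/-- `dim ℂ[X₀, …, X_{m-1}] = m`. [folklore] -/
theorem ringKrullDim_mvPolynomial_fin_complex (m : ℕ) :
    ringKrullDim (MvPolynomial (Fin m) ℂ) = (m : WithBot ℕ∞) := by
  rw [MvPolynomial.ringKrullDim_of_isNoetherianRing, ringKrullDim_eq_zero_of_field, zero_add,
    Nat.card_eq_fintype_card, Fintype.card_fin]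

/-- Sets cut out by a set of polynomials over the prime field are `IsDefinedOver ⊥`. [folklore] -/
theorem isDefinedOver_bot_of_forall_iff {ι : Type*} (W : Set (ι → ℂ))
    (S : Set (MvPolynomial ι (⊥ : Subfield ℂ)))
    (h : ∀ w, w ∈ W ↔ ∀ p ∈ S, MvPolynomial.aeval w p = 0) :
    IsDefinedOver (⊥ : Subfield ℂ) W :=
  ⟨Ideal.span S, by ext w; rw [zeroLocus_span, Set.mem_setOf_eq]; exact h w⟩

/-! ## The witness points `x_k = (2πi(k+1), c)` -/

/-- The witness points: `x_k = (2πi(k+1), c)`. [folklore] -/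
def expWitnessPt (c : ℂ) (k : ℕ) : Fin 2 → ℂ := ![2 * π * I * (k + 1), c]

/-- First coordinate of `expWitnessPt c k`. [folklore] -/
@[simp] theorem expWitnessPt_zero (c : ℂ) (k : ℕ) : expWitnessPt c k 0 = 2 * π * I * (k + 1) := rfl
/-- Second coordinate of `expWitnessPt c k`. [folklore] -/
@[simp] theorem expWitnessPt_one (c : ℂ) (k : ℕ) : expWitnessPt c k 1 = c := rfl

/-- `k ↦ expWitnessPt c k` is injective (first coordinates `2πi(k+1)` are distinct). [folklore] -/
theorem expWitnessPt_injective (c : ℂ) : Function.Injective (expWitnessPt c) := by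
  intro j k hjk
  have h := congrFun hjk 0
  simp only [expWitnessPt_zero] at h
  have h2 : (2 * π * I : ℂ) ≠ 0 := by simp [Real.pi_ne_zero, I_ne_zero]
  have h3 : ((j : ℂ) + 1) = (k : ℂ) + 1 := mul_left_cancel₀ h2 h
  exact_mod_cast add_right_cancel h3

/-- `exp (2πi(k+1)) = 1`. [folklore] -/
@[simp] theorem exp_two_pi_I_mul_succ (k : ℕ) : Complex.exp (2 * π * I * (k + 1)) = 1 := by
  have : (2 * π * I * (k + 1) : ℂ) = ((k + 1 : ℕ) : ℂ) * (2 * π * I) := by push_cast; ring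
  rw [this, Complex.exp_nat_mul_two_pi_mul_I]

/-- `exp` of the first coordinate of `expWitnessPt c k` is `1`. [folklore] -/
theorem exp_expWitnessPt_zero (c : ℂ) (k : ℕ) : Complex.exp (expWitnessPt c k 0) = 1 := by
  rw [expWitnessPt_zero, exp_two_pi_I_mul_succ]

/-- `(2πi(k+1), c)` is ℚ-linearly independent for real `c ≠ 0` (imaginary vs real parts; no
transcendence needed). [folklore] -/
theorem linearIndependent_expWitnessPt {c : ℝ} (hc : c ≠ 0) (k : ℕ) :
    LinearIndependent ℚ (expWitnessPt (c : ℂ) k) := by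
  rw [expWitnessPt, LinearIndependent.pair_iff]
  intro s t hst
  have hst' : ((s : ℂ) * (((2 * π * ((k : ℝ) + 1) : ℝ) : ℂ) * I) + (t : ℂ) * (c : ℂ)) = 0 := by
    rw [Rat.smul_def, Rat.smul_def] at hst
    rw [← hst]
    push_cast
    ring
  have hk : (k : ℝ) + 1 ≠ 0 := by positivity
  have him := congrArg Complex.im hst'
  have hre := congrArg Complex.re hst'
  simp [hk, hc, Real.pi_ne_zero] at him hre
  exact ⟨by simpa using him, by simpa using hre⟩

/-- Coordinate `x₁` of the graph point of `expWitnessPt c k`. [folklore] -/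
@[simp] theorem graph_expWitnessPt_inl_zero (c : ℂ) (k : ℕ) :
    Sum.elim (expWitnessPt c k) (Complex.exp ∘ expWitnessPt c k) (Sum.inl 0) = 2 * π * I * (k + 1) := rfl
/-- Coordinate `x₂` of the graph point of `expWitnessPt c k`. [folklore] -/
@[simp] theorem graph_expWitnessPt_inl_one (c : ℂ) (k : ℕ) :
    Sum.elim (expWitnessPt c k) (Complex.exp ∘ expWitnessPt c k) (Sum.inl 1) = c := rfl
/-- Coordinate `y₁ = 1` of the graph point of `expWitnessPt c k`. [folklore] -/
@[simp] theorem graph_expWitnessPt_inr_zero (c : ℂ) (k : ℕ) :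
    Sum.elim (expWitnessPt c k) (Complex.exp ∘ expWitnessPt c k) (Sum.inr 0) = 1 := by
  simp
/-- Coordinate `y₂ = e^c` of the graph point of `expWitnessPt c k`. [folklore] -/
@[simp] theorem graph_expWitnessPt_inr_one (c : ℂ) (k : ℕ) :
    Sum.elim (expWitnessPt c k) (Complex.exp ∘ expWitnessPt c k) (Sum.inr 1) = Complex.exp c := rfl

/-- `1 < 2` in `WithBot ℕ∞`. [folklore] -/
theorem one_lt_two_withBot : ((1 : ℕ) : WithBot ℕ∞) < 2 := by decide
/-- `2 < 3` in `WithBot ℕ∞`. [folklore] -/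
theorem two_lt_three_withBot : ((2 : ℕ) : WithBot ℕ∞) < 3 := by decide

/-! ## Example 1: a line over `ℚ(e)` — the field of definition is load-bearing -/

/-- The line `{x₂ = 1, y₁ = 1, y₂ = e}` — defined over `ℚ(e) ⊂ ℝ`, not over `ℚ̄`. [folklore] -/
def expLineE : Set (Fin 2 ⊕ Fin 2 → ℂ) :=
  {w | w (Sum.inl 1) = 1 ∧ w (Sum.inr 0) = 1 ∧ w (Sum.inr 1) = Complex.exp 1}

/-- `expLineE` is Zariski closed over ℂ (cut out by `x₂ - 1, y₁ - 1, y₂ - e`). [folklore] -/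
theorem isZariskiClosed_expLineE : IsZariskiClosed ℂ expLineE := by
  refine ⟨Ideal.span {X (Sum.inl 1) - C 1, X (Sum.inr 0) - C 1, X (Sum.inr 1) - C (Complex.exp 1)},
    ?_⟩
  ext w
  simp only [expLineE, Set.mem_setOf_eq, zeroLocus_span, Set.mem_insert_iff, Set.mem_singleton_iff,
    forall_eq_or_imp, forall_eq, map_sub, aeval_X, aeval_C, sub_eq_zero]
  rfl

/-- `expLineE` has dimension `≤ 1 < 2` (every coordinate is a polynomial in `x₁`). [folklore] -/
theorem zariskiDim_expLineE : zariskiDim ℂ expLineE < 2 := by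
  refine lt_of_le_of_lt ?_ (lt_of_eq_of_lt (ringKrullDim_mvPolynomial_fin_complex 1)
    one_lt_two_withBot)
  refine zariskiDim_le_of_coord_polys expLineE (fun _ : Fin 1 => Sum.inl 0) ?_
  rintro (i | i) <;> fin_cases i
  · exact ⟨X 0, fun w _ => by simp⟩
  · exact ⟨C 1, fun w hw => by simpa using hw.1⟩
  · exact ⟨C 1, fun w hw => by simpa using hw.2.1⟩
  · exact ⟨C (Complex.exp 1), fun w hw => by simpa using hw.2.2⟩

/-- The points `expWitnessPt 1 k` are ℚ-independent graph points on `expLineE`. [folklore] -/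
theorem expWitnessPt_mem_indepExpPoints_expLineE (k : ℕ) : expWitnessPt (1 : ℂ) k ∈ indepExpPoints expLineE := by
  refine ⟨by exact_mod_cast linearIndependent_expWitnessPt one_ne_zero k, ?_, ?_, ?_⟩ <;> simp

/-- `expLineE` carries infinitely many ℚ-independent graph points. [folklore] -/
theorem infinite_indepExpPoints_expLineE : (indepExpPoints expLineE).Infinite :=
  Set.infinite_of_injective_forall_mem (expWitnessPt_injective 1) expWitnessPt_mem_indepExpPoints_expLineE

/-- **The field of definition is load-bearing**: there is a Zariski-closed `W ⊆ ℂ² × ℂ²` of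
dimension `< 2` (the line `{x₂ = 1, y₁ = 1, y₂ = e}`, defined over `ℚ(e) ⊂ ℝ`) with infinitely
many ℚ-independent exponential points. [folklore] -/
theorem exists_isZariskiClosed_dim_lt_two_infinite_indepExpPoints :
    ∃ W : Set (Fin 2 ⊕ Fin 2 → ℂ), IsZariskiClosed ℂ W ∧ zariskiDim ℂ W < 2 ∧
      (indepExpPoints W).Infinite :=
  ⟨expLineE, isZariskiClosed_expLineE, zariskiDim_expLineE, infinite_indepExpPoints_expLineE⟩

/-! ## Example 2: all of `ℂ⁴`, and a ℚ-line with dependent points -/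

/-- `ℂ⁴ = Z(0)` is defined over the prime field. [folklore] -/
theorem isDefinedOver_bot_univ : IsDefinedOver (⊥ : Subfield ℂ) (Set.univ : Set (Fin 2 ⊕ Fin 2 → ℂ)) :=
  isDefinedOver_bot_of_forall_iff _ ∅ fun w => by simp

/-- **The dimension bound is load-bearing**: `ℂ⁴` (defined over ℚ) has infinitely many
ℚ-independent exponential points. [folklore] -/
theorem infinite_indepExpPoints_univ :
    (indepExpPoints (Set.univ : Set (Fin 2 ⊕ Fin 2 → ℂ))).Infinite :=
  Set.infinite_of_injective_forall_mem (expWitnessPt_injective 1) fun k =>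
    ⟨by exact_mod_cast linearIndependent_expWitnessPt one_ne_zero k, Set.mem_univ _⟩

/-- The ℚ-line `{y₁ = 1, y₂ = 1, x₂ = 2x₁}`. [folklore] -/
def expLineDep : Set (Fin 2 ⊕ Fin 2 → ℂ) :=
  {w | w (Sum.inr 0) = 1 ∧ w (Sum.inr 1) = 1 ∧ w (Sum.inl 1) = 2 * w (Sum.inl 0)}

/-- `expLineDep` is defined over the prime field. [folklore] -/
theorem isDefinedOver_expLineDep : IsDefinedOver (⊥ : Subfield ℂ) expLineDep := by
  refine isDefinedOver_bot_of_forall_iff expLineDep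
    {X (Sum.inr 0) - 1, X (Sum.inr 1) - 1, X (Sum.inl 1) - 2 * X (Sum.inl 0)} fun w => ?_
  simp only [expLineDep, Set.mem_setOf_eq, Set.mem_insert_iff, Set.mem_singleton_iff,
    forall_eq_or_imp, forall_eq, map_sub, map_mul, aeval_X, map_one, sub_eq_zero, map_ofNat]

/-- `expLineDep` has dimension `≤ 1 < 2`. [folklore] -/
theorem zariskiDim_expLineDep : zariskiDim ℂ expLineDep < 2 := by
  refine lt_of_le_of_lt ?_ (lt_of_eq_of_lt (ringKrullDim_mvPolynomial_fin_complex 1)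
    one_lt_two_withBot)
  refine zariskiDim_le_of_coord_polys expLineDep (fun _ : Fin 1 => Sum.inl 0) ?_
  rintro (i | i) <;> fin_cases i
  · exact ⟨X 0, fun w _ => by simp⟩
  · exact ⟨2 * X 0, fun w hw => by simpa using hw.2.2⟩
  · exact ⟨C 1, fun w hw => by simpa using hw.1⟩
  · exact ⟨C 1, fun w hw => by simpa using hw.2.1⟩

/-- Dependent witness points `(2πi(k+1), 4πi(k+1))`. [folklore] -/
def expWitnessPtDep (k : ℕ) : Fin 2 → ℂ := ![2 * π * I * (k + 1), 2 * (2 * π * I * (k + 1))]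

/-- `expWitnessPtDep` is injective. [folklore] -/
theorem expWitnessPtDep_injective : Function.Injective expWitnessPtDep := by
  intro j k hjk
  have h := congrFun hjk 0
  simp only [expWitnessPtDep, Matrix.cons_val_zero] at h
  have h2 : (2 * π * I : ℂ) ≠ 0 := by simp [Real.pi_ne_zero, I_ne_zero]
  have h3 : ((j : ℂ) + 1) = (k : ℂ) + 1 := mul_left_cancel₀ h2 h
  exact_mod_cast add_right_cancel h3

/-- The points `expWitnessPtDep k` have pairwise-distinct nonzero coordinates and their graph points lie on
`expLineDep`. [folklore] -/
theorem expWitnessPtDep_mem (k : ℕ) :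
    expWitnessPtDep k ∈ {x : Fin 2 → ℂ | (x 0 ≠ 0 ∧ x 1 ≠ 0 ∧ x 0 ≠ x 1) ∧
      Sum.elim x (Complex.exp ∘ x) ∈ expLineDep} := by
  have h2 : (2 * π * I * (k + 1) : ℂ) ≠ 0 := by
    have : ((k : ℂ) + 1) ≠ 0 := by exact_mod_cast Nat.succ_ne_zero k
    simp [Real.pi_ne_zero, I_ne_zero, this]
  have hexp : Complex.exp (2 * π * I * (k + 1)) = 1 := exp_two_pi_I_mul_succ k
  have hexp2 : Complex.exp (2 * (2 * π * I * (k + 1))) = 1 := by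
    rw [two_mul, Complex.exp_add, hexp, mul_one]
  refine ⟨⟨?_, ?_, ?_⟩, ?_, ?_, ?_⟩
  · simpa [expWitnessPtDep] using h2
  · simpa [expWitnessPtDep] using h2
  · simp only [expWitnessPtDep, Matrix.cons_val_zero, Matrix.cons_val_one]
    intro h
    exact h2 (by linear_combination (-1 : ℂ) * h)
  · simp [expWitnessPtDep, hexp]
  · simp [expWitnessPtDep, hexp2]
  · simp [expWitnessPtDep]

/-- **ℚ-linear independence of `x` is load-bearing**: the ℚ-line `{y₁ = 1, y₂ = 1, x₂ = 2x₁}`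
(dimension `< 2`) carries infinitely many exponential points with pairwise-distinct nonzero
coordinates, `(2πi(k+1), 4πi(k+1))`, `k ∈ ℕ`. [folklore] -/
theorem infinite_depExpPoints_expLineDep :
    Set.Infinite {x : Fin 2 → ℂ | (x 0 ≠ 0 ∧ x 1 ≠ 0 ∧ x 0 ≠ x 1) ∧
      Sum.elim x (Complex.exp ∘ x) ∈ expLineDep} :=
  Set.infinite_of_injective_forall_mem expWitnessPtDep_injective expWitnessPtDep_mem

/-- Existential form of `infinite_depExpPoints_expLineDep`: a set defined over ℚ of dimension `< 2`
with infinitely many non-degenerate (but ℚ-dependent) exponential points. [folklore] -/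
theorem exists_definedOver_dim_lt_two_infinite_depExpPoints :
    ∃ W : Set (Fin 2 ⊕ Fin 2 → ℂ), IsDefinedOver (⊥ : Subfield ℂ) W ∧ zariskiDim ℂ W < 2 ∧
      Set.Infinite {x : Fin 2 → ℂ | (x 0 ≠ 0 ∧ x 1 ≠ 0 ∧ x 0 ≠ x 1) ∧
        Sum.elim x (Complex.exp ∘ x) ∈ W} :=
  ⟨expLineDep, isDefinedOver_expLineDep, zariskiDim_expLineDep, infinite_depExpPoints_expLineDep⟩

/-! ## Example 3: a ℚ-plane — the dimension bound is tight -/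

/-- The ℚ-plane `{x₂ = 1, y₁ = 1}`. [folklore] -/
def expPlaneQ : Set (Fin 2 ⊕ Fin 2 → ℂ) :=
  {w | w (Sum.inl 1) = 1 ∧ w (Sum.inr 0) = 1}

/-- `expPlaneQ` is defined over the prime field. [folklore] -/
theorem isDefinedOver_expPlaneQ : IsDefinedOver (⊥ : Subfield ℂ) expPlaneQ := by
  refine isDefinedOver_bot_of_forall_iff expPlaneQ {X (Sum.inl 1) - 1, X (Sum.inr 0) - 1} fun w => ?_
  simp only [expPlaneQ, Set.mem_setOf_eq, Set.mem_insert_iff, Set.mem_singleton_iff,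
    forall_eq_or_imp, forall_eq, map_sub, aeval_X, map_one, sub_eq_zero]

/-- `expPlaneQ` has dimension `≤ 2 < 3` (coordinates are polynomials in `x₁, y₂`). [folklore] -/
theorem zariskiDim_expPlaneQ : zariskiDim ℂ expPlaneQ < 3 := by
  refine lt_of_le_of_lt ?_ (lt_of_eq_of_lt (ringKrullDim_mvPolynomial_fin_complex 2)
    two_lt_three_withBot)
  refine zariskiDim_le_of_coord_polys expPlaneQ (![Sum.inl 0, Sum.inr 1] : Fin 2 → Fin 2 ⊕ Fin 2) ?_
  rintro (i | i) <;> fin_cases i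
  · exact ⟨X 0, fun w _ => by simp⟩
  · exact ⟨C 1, fun w hw => by simpa using hw.1⟩
  · exact ⟨C 1, fun w hw => by simpa using hw.2⟩
  · exact ⟨X 1, fun w _ => by simp⟩

/-- The points `expWitnessPt 1 k` are ℚ-independent graph points on `expPlaneQ`. [folklore] -/
theorem expWitnessPt_mem_indepExpPoints_expPlaneQ (k : ℕ) : expWitnessPt (1 : ℂ) k ∈ indepExpPoints expPlaneQ := by
  refine ⟨by exact_mod_cast linearIndependent_expWitnessPt one_ne_zero k, ?_, ?_⟩ <;> simp

/-- `expPlaneQ` carries infinitely many ℚ-independent exponential points. [folklore] -/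
theorem infinite_indepExpPoints_expPlaneQ : (indepExpPoints expPlaneQ).Infinite :=
  Set.infinite_of_injective_forall_mem (expWitnessPt_injective 1)
    expWitnessPt_mem_indepExpPoints_expPlaneQ

/-- **The dimension bound is tight**: a set defined over ℚ of dimension `< 3` (the ℚ-plane
`{x₂ = 1, y₁ = 1}`) with infinitely many ℚ-independent exponential points. [folklore] -/
theorem exists_definedOver_dim_lt_three_infinite_indepExpPoints :
    ∃ W : Set (Fin 2 ⊕ Fin 2 → ℂ), IsDefinedOver (⊥ : Subfield ℂ) W ∧ zariskiDim ℂ W < 3 ∧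
      (indepExpPoints W).Infinite :=
  ⟨expPlaneQ, isDefinedOver_expPlaneQ, zariskiDim_expPlaneQ, infinite_indepExpPoints_expPlaneQ⟩

/-! ## Example 4: ℚ-lines `{x₂ = c, y₁ = 1, y₂ = d}` — the arithmetic content -/

/-- The ℚ-line `{x₂ = c, y₁ = 1, y₂ = d}` for rationals `c, d`. [folklore] -/
def expLineRat (c d : ℚ) : Set (Fin 2 ⊕ Fin 2 → ℂ) :=
  {w | w (Sum.inl 1) = c ∧ w (Sum.inr 0) = 1 ∧ w (Sum.inr 1) = d}

/-- `expLineRat c d` is defined over the prime field (`c, d ∈ ℚ`). [folklore] -/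
theorem isDefinedOver_expLineRat (c d : ℚ) : IsDefinedOver (⊥ : Subfield ℂ) (expLineRat c d) := by
  refine isDefinedOver_bot_of_forall_iff (expLineRat c d)
    {X (Sum.inl 1) - C (c : (⊥ : Subfield ℂ)), X (Sum.inr 0) - 1,
      X (Sum.inr 1) - C (d : (⊥ : Subfield ℂ))} fun w => ?_
  simp only [expLineRat, Set.mem_setOf_eq, Set.mem_insert_iff, Set.mem_singleton_iff,
    forall_eq_or_imp, forall_eq, map_sub, aeval_X, aeval_C, map_one, sub_eq_zero]
  have hc : algebraMap (⊥ : Subfield ℂ) ℂ (c : (⊥ : Subfield ℂ)) = (c : ℂ) := by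
    rw [map_ratCast]
  have hd : algebraMap (⊥ : Subfield ℂ) ℂ (d : (⊥ : Subfield ℂ)) = (d : ℂ) := by
    rw [map_ratCast]
  rw [hc, hd]

/-- `expLineRat c d` has dimension `≤ 1 < 2`. [folklore] -/
theorem zariskiDim_expLineRat (c d : ℚ) : zariskiDim ℂ (expLineRat c d) < 2 := by
  refine lt_of_le_of_lt ?_ (lt_of_eq_of_lt (ringKrullDim_mvPolynomial_fin_complex 1)
    one_lt_two_withBot)
  refine zariskiDim_le_of_coord_polys (expLineRat c d) (fun _ : Fin 1 => Sum.inl 0) ?_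
  rintro (i | i) <;> fin_cases i
  · exact ⟨X 0, fun w _ => by simp⟩
  · exact ⟨C (c : ℂ), fun w hw => by simpa using hw.1⟩
  · exact ⟨C 1, fun w hw => by simpa using hw.2.1⟩
  · exact ⟨C (d : ℂ), fun w hw => by simpa using hw.2.2⟩

/-- **The arithmetic content**: if `e^c = d` for rationals `c ≠ 0` and `d`, then the ℚ-line
`{x₂ = c, y₁ = 1, y₂ = d}` (dimension `< 2`, defined over ℚ) carries the infinitely many
ℚ-independent exponential points `(2πi(k+1), c)`. Contrapositively, finiteness of ℚ-independent
exponential points on ℚ-curves already contains `e^c ∉ ℚ` (`c ∈ ℚˣ`). [folklore] -/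
theorem infinite_indepExpPoints_expLineRat (c d : ℚ) (hc : c ≠ 0) (hcd : Complex.exp c = d) :
    (indepExpPoints (expLineRat c d)).Infinite := by
  refine Set.infinite_of_injective_forall_mem (expWitnessPt_injective (c : ℂ)) (fun k => ?_)
  have hli := linearIndependent_expWitnessPt (c := (c : ℝ)) (by exact_mod_cast hc) k
  rw [Complex.ofReal_ratCast] at hli
  refine ⟨hli, ?_, ?_, ?_⟩ <;> simp [hcd]

/-- Sparsity on ℚ-lines is irrationality of `e^c`: if for every `W` defined over ℚ with
`zariskiDim ℂ W < 2` the set `indepExpPoints W` is finite, then `e^c ≠ d` for all rationals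
`c ≠ 0`, `d`. [folklore] -/
theorem exp_rat_ne_rat_of_sparsity
    (h : ∀ W : Set (Fin 2 ⊕ Fin 2 → ℂ), IsDefinedOver (⊥ : Subfield ℂ) W → zariskiDim ℂ W < 2 →
      (indepExpPoints W).Finite)
    (c d : ℚ) (hc : c ≠ 0) : Complex.exp c ≠ d := fun hcd =>
  infinite_indepExpPoints_expLineRat c d hc hcd
    (h (expLineRat c d) (isDefinedOver_expLineRat c d) (zariskiDim_expLineRat c d))

end

end Literature.NumberTheory.Transcendental
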